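import Mathlib
import HarnessLib
import Summits.HubbardSuperconductivity.HubbardSuperconductivity.Theorems.KLProgrammeKLRegimeSplitTwoLegSizesMSChainTable
import Summits.HubbardSuperconductivity.HubbardSuperconductivity.Theorems.KLProgrammeKLRegimeSplitTwoLegSizesMSOfChain
import Summits.HubbardSuperconductivity.HubbardSuperconductivity.Theorems.KLProgrammePerturbedFermiCurveExplicit

/-!
# Route `KLProgramme`, crux K3 — gen-5 ENGINE child (stmt-…-19918, `stub_twoLeg_step`, clause `TwoLegSizesMST`), recipe (L)+(F):
# (E3a-MS) AT THE TOP SCALE `nScales β + 1` ((R1): the last slice is one more engine step)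

Seat hubbard-kl-k3c3-p1 (g3).  At `n = nScales β + 1` the slot range `Ioc n (nScales β)` is EMPTY: the witness is the piece itself,
`lp n = E(S∘k_F^K)` with `S` the increment symbol read at `K` (all pieces of `K` are now coarser than `n`, so its sizes `σ l`, `l ≤ 4`, are
clean), no chain.  `twoLegSizesMST_top_of_sizes` (frame-size keyed, P2-INTERFACE §1) and `twoLegSizesMST_top_of_frameOK` (KL regime,
thresholds `klCurveC3 R`, `klCurveU0 R`; frame budgets `topA3`, `topA4` of `frame_sizes_of_frameOK_explicit`).  Proofs only.
-/

noncomputable section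

namespace Summit.HubbardSuperconductivity.HubbardSuperconductivity.Theorems.KLRegimeSplit

set_option linter.dupNamespace false -- summit = problem name (single-conjunct summit), D-0017

open Real Finset Literature.MathematicalPhysics.QuantumLattice Literature.MathematicalPhysics.QuantumLattice.FermiRG
open Literature.MathematicalPhysics.QuantumLattice.BandSectorCounting
open Summit.HubbardSuperconductivity.HubbardSuperconductivity.Theorems.KLProgrammeLegKernels
open Summit.HubbardSuperconductivity.HubbardSuperconductivity.Theorems.DispersionFlow
open Summit.HubbardSuperconductivity.HubbardSuperconductivity.Theorems.PerturbedFermiCurve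

/-- The frame order-3 budget `Gfr₃U²·4^{N+1}/3`. -/
def topA3 (R : RenConsts) (U : ℝ) (N : ℕ) : ℝ := R.Gfr 3 * U ^ 2 * ((4 : ℝ) ^ (N + 1) / 3)

/-- The frame order-4 budget `Gfr₄U²·16^{N+1}/15`. -/
def topA4 (R : RenConsts) (U : ℝ) (N : ℕ) : ℝ := R.Gfr 4 * U ^ 2 * ((16 : ℝ) ^ (N + 1) / 15)

section MS

variable {L M : ℕ} [NeZero L] [NeZero M] {G : GeoConsts} {Q : EngConsts} {R : RenConsts} {β U μ : ℝ}

/-- **(E3a-MS) AT THE TOP SCALE, frame-size keyed.**  See the module docstring. -/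
theorem twoLegSizesMST_top_of_sizes (hμ : μ ∈ klWindowC) {K : TrigPolyC4v}
    (hc₁ : Continuous (klLocalPart L M β U μ K (nScales β + 1))) (hc₀ : Continuous (klLocalPart L M β U μ K (nScales β)))
    {S : TrigPolyC4v}
    (hS : ∀ θ, klLocalPart L M β U μ K (nScales β + 1) θ - klLocalPart L M β U μ K (nScales β) θ = S.eval (klFermiPoint μ K θ))
    {A : ℝ} (hA : ∀ p : Momentum, ∀ j ≤ 2, ‖iteratedFDeriv ℝ j (frameShift K) p‖ ≤ A) (hA20 : A ≤ 1 / 20)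
    (hd : klCurveD ≤ (bandBounds (show (-4 : ℝ) < -1.1 by norm_num) (show (-1.1 : ℝ) ≤ -0.1 by norm_num)
      (show (-0.1 : ℝ) < 0 by norm_num)).Dtmin - 2 * A)
    (hlo : (-1.1 : ℝ) ≤ μ - A) (hhi : μ + A ≤ -0.1)
    {A₃ A₄ : ℝ} (hA₃ : ∀ p : Momentum, ‖iteratedFDeriv ℝ 3 (frameShift K) p‖ ≤ A₃)
    (hA₄ : ∀ p : Momentum, ‖iteratedFDeriv ℝ 4 (frameShift K) p‖ ≤ A₄)
    {σ : ℕ → ℝ} (hσnn : ∀ l, 0 ≤ σ l) (hσ0 : ∀ q : Momentum, |evalM S q| ≤ σ 0)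
    (hσ : ∀ l, 1 ≤ l → l ≤ 4 → ∀ q : Momentum, ‖iteratedFDeriv ℝ l (evalM S) q‖ ≤ σ l)
    {X : ℝ} (hX : ∀ l ≤ 4, ∀ x : ℝ, ‖iteratedFDeriv ℝ l salmhoferCutoff x‖ ≤ X)
    (hfit : ∀ j ≤ 4, (if j = 0 then σ 0 else 0) +
      (j.factorial : ℝ) ^ 2 * (2 * j.factorial * X * 200 ^ j) * bellCum σ (msD A₃ A₄) j *
        (4 + max 1 (((j - 1).factorial : ℝ) / (8 / 5))) ^ j ≤ twoLegBar G Q U j (nScales β + 1)) :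
    TwoLegSizesMST L M G Q R β U μ K (nScales β + 1) := by
  set N := nScales β with hNdef
  -- the curve of `K`
  have hcurve := fermiPointLp_sizes_of_sizes hA hA20 hd hlo hhi hA₃ hA₄
  have hC : ContDiff ℝ 4 (fun θ : ℝ => (WithLp.toLp 2 (klFermiPoint μ K θ) : Momentum)) := (hcurve 0).1
  have hC' : ContDiff ℝ 4 (klFermiPoint μ K) := contDiff_of_contDiff_toLp hC
  have hD : ∀ i, 1 ≤ i → i ≤ 4 → ∀ θ,
      ‖iteratedDeriv i (fun θ : ℝ => (WithLp.toLp 2 (klFermiPoint μ K θ) : Momentum)) θ‖ ≤ msD A₃ A₄ i := by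
    intro i hi1 hi4 θ
    obtain ⟨-, d1, d2, d3, d4⟩ := hcurve θ
    rw [← norm_iteratedFDeriv_eq_norm_iteratedDeriv]
    interval_cases i
    · exact d1
    · exact d2
    · exact d3
    · exact d4
  have hDnn : ∀ i, 0 ≤ msD A₃ A₄ i := by
    intro i
    rcases i with _ | _ | _ | _ | _ | i
    · simp [msD]
    · exact (norm_nonneg _).trans (hD 1 le_rfl (by norm_num) 0)
    · exact (norm_nonneg _).trans (hD 2 (by norm_num) (by norm_num) 0)
    · exact (norm_nonneg _).trans (hD 3 (by norm_num) (by norm_num) 0)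
    · exact (norm_nonneg _).trans (hD 4 (by norm_num) (by norm_num) 0)
    · simp [msD]
  -- the piece
  have hδ : (fun θ => klLocalPart L M β U μ K (N + 1) θ - klLocalPart L M β U μ K N θ) = curveProfile μ S K := by
    funext θ; rw [hS θ]; rfl
  have hP : klTwoLegPieceFn L M β U μ K.eval (N + 1) = klFrameExtFn μ (curveProfile μ S K) := by
    rw [klTwoLegPieceFn_eval_succ β U μ K N hc₁ hc₀, hδ]
  -- the (trivial) split
  set p : ℕ → ℝ → ℝ := fun m => if m = N + 1 then curveProfile μ S K else fun _ => 0 with hpdef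
  have hpN : p (N + 1) = curveProfile μ S K := by simp [hpdef]
  have hpm : ∀ m, m ≠ N + 1 → p m = fun _ => 0 := fun m hm => by simp [hpdef, hm]
  have hempty : Ioc (N + 1) (nScales β) = ∅ := Finset.Ioc_eq_empty_of_le (by omega)
  refine twoLegSizesMST_of_profile_split hμ hP p ?_ ?_ ?_ ?_ ?_ hX
    (fun m j => if m = N + 1 then bellCum σ (msD A₃ A₄) j else 0) ?_ ?_ ?_
  · intro θ; rw [hempty, Finset.sum_empty, hpN, add_zero]
  · intro m
    by_cases hm : m = N + 1
    · subst hm; rw [hpN]; exact contDiff_curveProfile μ S K hC'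
    · rw [hpm m hm]; exact contDiff_const
  · intro m θ
    by_cases hm : m = N + 1
    · subst hm; simp only [hpN, curveProfile, klFermiPoint_periodic μ _ θ]
    · simp only [hpm m hm]
  · intro m θ
    by_cases hm : m = N + 1
    · subst hm; simp only [hpN, curveProfile, klFermiPoint_neg, TrigPolyC4v.eval_reflect]
    · simp only [hpm m hm]
  · intro m θ
    by_cases hm : m = N + 1
    · subst hm; simp only [hpN, curveProfile, klFermiPoint_pi_div_two_sub, TrigPolyC4v.eval_swap]
    · simp only [hpm m hm]
  · intro m j hj i hi t
    by_cases hm : m = N + 1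
    · subst hm
      rw [hpN, if_pos rfl]
      exact curveProfile_centred_sizes μ S K hC hσnn hDnn hσ0 hσ hD hj hi t
    · rw [hpm m hm, if_neg hm, klAngularMean_zero]
      simp
  · intro j hj
    refine le_trans ?_ (hfit j hj)
    rw [if_pos rfl, hpN]
    have h1 : (if j = 0 then |klAngularMean (curveProfile μ S K)| else 0) ≤ (if j = 0 then σ 0 else 0) := by
      split_ifs
      · refine abs_klAngularMean_le' fun θ => ?_
        rw [curveProfile_apply]; exact hσ0 _
      · exact le_rfl
    linarith
  · intro m hm
    rw [hempty] at hm
    exact absurd hm (Finset.notMem_empty m)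

/-- **(E3a-MS) AT THE TOP SCALE IN THE KL REGIME** (`FrameOK`-keyed, thresholds `klCurveC3 R`, `klCurveU0 R`). -/
theorem twoLegSizesMST_top_of_frameOK (hR : ∀ j, 0 ≤ R.Gfr j) {c : ℝ} (hc : 0 < c) (hcle : c ≤ klCurveC3 R)
    (hU : 0 < U) (hUle : U ≤ klCurveU0 R) (hβmin : klBetaMin ≤ β) (hβc : β ≤ Real.exp (c / U ^ 2)) (hμ : μ ∈ klWindowC)
    {K : TrigPolyC4v} (hK : FrameOK R U (nScales β) μ K)
    (hc₁ : Continuous (klLocalPart L M β U μ K (nScales β + 1))) (hc₀ : Continuous (klLocalPart L M β U μ K (nScales β)))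
    {S : TrigPolyC4v}
    (hS : ∀ θ, klLocalPart L M β U μ K (nScales β + 1) θ - klLocalPart L M β U μ K (nScales β) θ = S.eval (klFermiPoint μ K θ))
    {σ : ℕ → ℝ} (hσnn : ∀ l, 0 ≤ σ l) (hσ0 : ∀ q : Momentum, |evalM S q| ≤ σ 0)
    (hσ : ∀ l, 1 ≤ l → l ≤ 4 → ∀ q : Momentum, ‖iteratedFDeriv ℝ l (evalM S) q‖ ≤ σ l)
    {X : ℝ} (hX : ∀ l ≤ 4, ∀ x : ℝ, ‖iteratedFDeriv ℝ l salmhoferCutoff x‖ ≤ X)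
    (hfit : ∀ j ≤ 4, (if j = 0 then σ 0 else 0) +
      (j.factorial : ℝ) ^ 2 * (2 * j.factorial * X * 200 ^ j) *
        bellCum σ (msD (topA3 R U (nScales β)) (topA4 R U (nScales β))) j *
        (4 + max 1 (((j - 1).factorial : ℝ) / (8 / 5))) ^ j ≤ twoLegBar G Q U j (nScales β + 1)) :
    TwoLegSizesMST L M G Q R β U μ K (nScales β + 1) := by
  obtain ⟨hAf, hA20, -, hhalf, ⟨hlo, hhi⟩, hA3f, hA4f⟩ := frame_sizes_of_frameOK_explicit hR hc hcle hU hUle hβmin hβc hμ hK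
  exact twoLegSizesMST_top_of_sizes hμ hc₁ hc₀ hS hAf hA20 hhalf hlo hhi hA3f hA4f hσnn hσ0 hσ hX hfit

end MS

end Summit.HubbardSuperconductivity.HubbardSuperconductivity.Theorems.KLRegimeSplit

end
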